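import Mathlib.Analysis.Convex.Jensen
import Mathlib.Analysis.Convex.Deriv
import Summits.Ventures.LatticeQCDFlow.Scaling.SwapLadderRoundTrip
import Summits.Ventures.LatticeQCDFlow.Scaling.SwapLadderLogConcave

/-!
HONEST FRAMING: exact (Metropolis-corrected) sampling algorithms for lattice gauge theory; figures
of merit are autocorrelation/cost numbers at stated couplings and volumes; no continuum-physics
claim.

# SwapLadderRoundTripOptimum — IN THE GAUSSIAN SWAP MODEL THE EQUAL-ACCEPTANCE LADDER MINIMISES THE
# ROUND-TRIP TIME ITSELF AMONG ALL `K`-INTERVAL LADDERS WITH THE SAME ENDPOINTS, UNIQUELY: `1/erfc` IS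
# STRICTLY CONVEX, SO `Σ_i 1/gaussAcc(gap_i) ≥ K/gaussAcc(Λ/K)` (row 22 `su3-ptbc`, GEN-5, ours; part 2
# of 2, sequel of `SwapLadderRoundTrip`)

Venture `LatticeQCDFlow` (cell pub-lqcd), topic `Scaling`; FANOUT row 22 (`su3-ptbc`, PTBC comparator arm
E4).  NEW WORK of the cell = Jensen's inequality (Mathlib `ConvexOn.map_sum_le`,
`StrictConvexOn.map_sum_lt_iff_of_pos'`, `StrictMono.strictConvexOn_univ_of_deriv`) over the tree's
`SwapLadderRoundTrip` (`profile_round_trip`: round trip `= 2(K+1)·Σ_i 1/a_i`), `SwapLadderLogConcave`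
(`gaussAcc ℓ = erfc(ℓ/(2√2))`, `strictAnti_erfcLogDeriv`, `hasDerivAt_log_gaussAcc`) and
`SwapLadderMinimax` (`ladderGap`, `uniformLadder`, `sum_ladderGap`).  Nothing is cited as a fact.
GEN-4 proved the equal-stiffness ladder MINIMAX for the worst pair (`SwapLadderMinimax`) and optimal for
the PRODUCT of the acceptances (`SwapLadderLogConcave`), with round trips "NOT CLAIMED"; this file closes
that gap inside the model.

## What is proved (ladders `g : ℕ → ℝ` in the stiffness coordinate, gaps `ladderGap g i`, `K ≥ 1`
## intervals, `Λ = g K − g 0`; model profile `ladderProfile g i = gaussAcc (ladderGap g i)`)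

* `gaussInvAcc ℓ = 1/gaussAcc ℓ`: positive, continuous, strictly increasing; `hasDerivAt_gaussInvAcc`
  (`gaussInvAcc′ = gaussInvAcc · gaussNegLogDeriv`, `gaussNegLogDeriv = −(log gaussAcc)′ > 0` strictly
  increasing by the log-concavity of `erfc`); **`strictConvexOn_gaussInvAcc`** — `ℓ ↦ 1/erfc(ℓ/(2√2))` IS
  STRICTLY CONVEX on `ℝ`;
* via `SwapLadderMinimax` §5 (GEN-6 append: Jensen `K·C(Λ/K) ≤ Σ_i C(gap_i)` for any (strictly) convex pair
  cost, strict if some gap `≠ Λ/K`): `mul_gaussInvAcc_div_le_sum` / `_lt_sum`,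
  `sum_gaussInvAcc_uniformLadder` (the uniform ladder attains `K/gaussAcc(Λ/K)`);
* **`model_round_trip`** `= 2(K+1)·Σ_i 1/gaussAcc(gap_i)` (monotone `g`);
  `model_round_trip_uniformLadder` `= 2K(K+1)/gaussAcc(Λ/K)` (GEN-4's `2K(K+1)/a`);
  **`model_round_trip_ge`** — EVERY monotone `K`-interval ladder's model round trip is
  `≥ 2K(K+1)/gaussAcc(Λ/K)`; **`model_round_trip_gt_of_ne_uniform`** — STRICTLY larger unless every gap
  is `Λ/K`; `ladderGap_eq_div_of_model_round_trip_eq` — attaining the bound forces the uniform ladder.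
  In the model, the card's equal-acceptance re-spacing rule (CARD-su3-ptbc §1.6) is the UNIQUE minimiser
  of the round-trip time at a fixed number of replicas.

Printed counterparts, NAMED ONLY (nothing used): Katzgraber–Trebst–Huse–Troyer, J. Stat. Mech. (2006)
P03018 (feedback-optimised ladders; constant acceptance is optimal where the diffusivity is uniform);
Nadler–Hansmann, Phys. Rev. E 75 (2007) 026109; the `≈ 20–23 %` constant-acceptance practice (Kone–Kofke
2005, Rathore–Chopra–de Pablo 2005; Bonanno–Bonati–D'Elia 2021 for PTBC).  Literature grade (cell rule):
KNOWN MECHANISM, NEW TYPING (Jensen optimality and uniqueness in the exact `erfc` model, kernel-checked).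
NOT CLAIMED: that the model describes PTBC at the card's points (the canaries measure that); the
optimisation over the number of intervals `K` (the continuum proxy `(Λ/ℓ)²/erfc(ℓ/(2√2))` is
`SwapAcceptanceOptimum`; the exact `2K(K+1)/gaussAcc(Λ/K)` over `K ∈ ℕ` is not treated); anything about a
run or a number of ours.
-/

noncomputable section

open Finset Real
open Literature.Probability.MarkovChains
open Literature.ComputerArithmetic.BrentZimmermann2010.AsymptoticExpansions (erfc erfc_pos)

namespace Summit.Ventures.LatticeQCDFlow.Scaling

/-! ## The Gaussian swap model: `1/erfc` is strictly convex, so the equal-stiffness ladder minimises the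
round trip among all `K`-interval ladders, uniquely -/

section Gauss

/-- The pair cost of the model round trip: `gaussInvAcc ℓ = 1/gaussAcc ℓ = 1/erfc(ℓ/(2√2))`. [ours] -/
def gaussInvAcc (ℓ : ℝ) : ℝ := 1 / gaussAcc ℓ

/-- `gaussInvAcc ℓ = 1 / gaussAcc ℓ`. [ours] -/
theorem gaussInvAcc_apply (ℓ : ℝ) : gaussInvAcc ℓ = 1 / gaussAcc ℓ := rfl

/-- `gaussInvAcc > 0`. [ours] -/
theorem gaussInvAcc_pos (ℓ : ℝ) : 0 < gaussInvAcc ℓ := one_div_pos.mpr (gaussAcc_pos ℓ)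

/-- `gaussInvAcc` is strictly increasing (`gaussAcc` is strictly decreasing and positive). [ours] -/
theorem strictMono_gaussInvAcc : StrictMono gaussInvAcc := fun _ y hxy =>
  one_div_lt_one_div_of_lt (gaussAcc_pos y) (strictAnti_gaussAcc hxy)

/-- `gaussInvAcc` is continuous. [ours] -/
theorem continuous_gaussInvAcc : Continuous gaussInvAcc :=
  continuous_const.div continuous_gaussAcc fun ℓ => (gaussAcc_pos ℓ).ne'

/-- Minus the logarithmic derivative of `gaussAcc`: `−erfcLogDeriv(ℓ/(2√2))/(2√2)`. [ours] -/
def gaussNegLogDeriv (ℓ : ℝ) : ℝ := -(erfcLogDeriv (ℓ / (2 * sqrt 2)) * (1 / (2 * sqrt 2)))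

/-- `−(log gaussAcc)′ > 0`. [ours] -/
theorem gaussNegLogDeriv_pos (ℓ : ℝ) : 0 < gaussNegLogDeriv ℓ := by
  unfold gaussNegLogDeriv erfcLogDeriv
  have h1 : 0 < 2 / sqrt π * exp (-((ℓ / (2 * sqrt 2)) ^ 2)) := by positivity
  have h2 : 0 < erfc (ℓ / (2 * sqrt 2)) := erfc_pos _
  have h3 : (0 : ℝ) < 1 / (2 * sqrt 2) := by positivity
  have h4 : -(2 / sqrt π * exp (-((ℓ / (2 * sqrt 2)) ^ 2))) / erfc (ℓ / (2 * sqrt 2)) < 0 :=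
    div_neg_of_neg_of_pos (neg_neg_of_pos h1) h2
  nlinarith

/-- `−(log gaussAcc)′` is strictly increasing (log-concavity of `erfc`: `strictAnti_erfcLogDeriv`). [ours] -/
theorem strictMono_gaussNegLogDeriv : StrictMono gaussNegLogDeriv := by
  intro x y hxy
  unfold gaussNegLogDeriv
  have hc : (0 : ℝ) < 1 / (2 * sqrt 2) := by positivity
  have hxy' : x / (2 * sqrt 2) < y / (2 * sqrt 2) := div_lt_div_of_pos_right hxy (by positivity)
  have h := strictAnti_erfcLogDeriv hxy'
  nlinarith

/-- `gaussInvAcc′ = gaussInvAcc · (−(log gaussAcc)′)`. [ours] -/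
theorem hasDerivAt_gaussInvAcc (ℓ : ℝ) :
    HasDerivAt gaussInvAcc (gaussInvAcc ℓ * gaussNegLogDeriv ℓ) ℓ := by
  have hfun : gaussInvAcc = fun y => exp (-Real.log (gaussAcc y)) := by
    funext y
    rw [gaussInvAcc_apply, exp_neg, exp_log (gaussAcc_pos y), one_div]
  have h1 : HasDerivAt (fun y => exp (-Real.log (gaussAcc y)))
      (exp (-Real.log (gaussAcc ℓ)) * (-(erfcLogDeriv (ℓ / (2 * sqrt 2)) * (1 / (2 * sqrt 2))))) ℓ :=
    ((hasDerivAt_log_gaussAcc ℓ).neg).exp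
  rw [hfun]
  exact h1

/-- `deriv gaussInvAcc = gaussInvAcc · gaussNegLogDeriv`. [ours] -/
theorem deriv_gaussInvAcc : deriv gaussInvAcc = fun ℓ => gaussInvAcc ℓ * gaussNegLogDeriv ℓ :=
  funext fun ℓ => (hasDerivAt_gaussInvAcc ℓ).deriv

/-- `gaussInvAcc′` is strictly increasing (product of two positive strictly increasing functions). [ours] -/
theorem strictMono_deriv_gaussInvAcc : StrictMono (deriv gaussInvAcc) := by
  rw [deriv_gaussInvAcc]
  intro x y hxy
  exact mul_lt_mul'' (strictMono_gaussInvAcc hxy) (strictMono_gaussNegLogDeriv hxy) (gaussInvAcc_pos x).le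
    (gaussNegLogDeriv_pos x).le

/-- **`ℓ ↦ 1/erfc(ℓ/(2√2))` IS STRICTLY CONVEX on `ℝ`.** [ours] -/
theorem strictConvexOn_gaussInvAcc : StrictConvexOn ℝ Set.univ gaussInvAcc :=
  strictMono_deriv_gaussInvAcc.strictConvexOn_univ_of_deriv continuous_gaussInvAcc

/-- **`K/gaussAcc(Λ/K) ≤ Σ_i 1/gaussAcc(gap_i)` for EVERY `K`-interval ladder** (`K ≥ 1`, no condition on
the gaps). [ours] -/
theorem mul_gaussInvAcc_div_le_sum {K : ℕ} (hK : 0 < K) (g : ℕ → ℝ) :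
    (K : ℝ) * gaussInvAcc ((g K - g 0) / K) ≤ ∑ i ∈ range K, gaussInvAcc (ladderGap g i) :=
  mul_cost_div_le_sum_cost hK g strictConvexOn_gaussInvAcc.convexOn fun _ _ => Set.mem_univ _

/-- Strict form: some gap `≠ Λ/K` ⇒ `K/gaussAcc(Λ/K) < Σ_i 1/gaussAcc(gap_i)`. [ours] -/
theorem mul_gaussInvAcc_div_lt_sum {K : ℕ} (hK : 0 < K) (g : ℕ → ℝ)
    (hne : ∃ i ∈ range K, ladderGap g i ≠ (g K - g 0) / K) :
    (K : ℝ) * gaussInvAcc ((g K - g 0) / K) < ∑ i ∈ range K, gaussInvAcc (ladderGap g i) :=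
  mul_cost_div_lt_sum_cost hK g strictConvexOn_gaussInvAcc (fun _ _ => Set.mem_univ _) hne

/-- The bound is attained by the uniform ladder: `Σ_i 1/gaussAcc(gap_i (uniform)) = K/gaussAcc(Λ/K)`.
[ours] -/
theorem sum_gaussInvAcc_uniformLadder (g₀ Λ : ℝ) (K : ℕ) :
    ∑ i ∈ range K, gaussInvAcc (ladderGap (uniformLadder g₀ Λ K) i) = (K : ℝ) * gaussInvAcc (Λ / K) := by
  simp [ladderGap_uniformLadder]

/-- **The model acceptance profile of a ladder** `g` in the stiffness coordinate: bond `i` accepts with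
`gaussAcc(gap_i) = erfc((g (i+1) − g i)/(2√2))`. [ours] -/
def ladderProfile (g : ℕ → ℝ) (i : ℕ) : ℝ := gaussAcc (ladderGap g i)

/-- The model profile takes values in `(0, 1]` for a monotone ladder. [ours] -/
theorem ladderProfile_pos (g : ℕ → ℝ) (i : ℕ) : 0 < ladderProfile g i := gaussAcc_pos _

/-- `gaussAcc ℓ ≤ 1` for `ℓ ≥ 0`. [ours] -/
theorem gaussAcc_le_one {ℓ : ℝ} (hℓ : 0 ≤ ℓ) : gaussAcc ℓ ≤ 1 := by
  rw [← gaussAcc_zero]; exact antitone_gaussAcc hℓ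

/-- For a monotone ladder every model acceptance is `≤ 1`. [ours] -/
theorem ladderProfile_le_one {g : ℕ → ℝ} (hg : Monotone g) (i : ℕ) : ladderProfile g i ≤ 1 :=
  gaussAcc_le_one (sub_nonneg.mpr (hg (Nat.le_succ i)))

variable {K : ℕ} {g : ℕ → ℝ} {h : Fin (K + 1) → Fin (K + 1) → ℝ}

/-- **THE MODEL ROUND TRIP OF A LADDER: `2(K+1)·Σ_{i<K} 1/gaussAcc(gap_i)`.** [ours] -/
theorem model_round_trip (hg : Monotone g) (hh : IsHittingTimeSolution (profileWalk K (ladderProfile g)) h) :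
    h 0 (Fin.last K) + h (Fin.last K) 0 =
      2 * ((K : ℝ) + 1) * ∑ i ∈ range K, gaussInvAcc (ladderGap g i) :=
  profile_round_trip (ladderProfile_pos g) (ladderProfile_le_one hg) hh

/-- The uniform ladder's model round trip is GEN-4's `2K(K+1)/a` with `a = gaussAcc(Λ/K)`. [ours] -/
theorem model_round_trip_uniformLadder {g₀ Λ : ℝ} (hΛ : 0 ≤ Λ)
    {h : Fin (K + 1) → Fin (K + 1) → ℝ}
    (hh : IsHittingTimeSolution (profileWalk K (ladderProfile (uniformLadder g₀ Λ K))) h) :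
    h 0 (Fin.last K) + h (Fin.last K) 0 = 2 * ((K : ℝ) * (K + 1)) / gaussAcc (Λ / K) := by
  rw [model_round_trip (monotone_uniformLadder g₀ hΛ K) hh, sum_gaussInvAcc_uniformLadder, gaussInvAcc_apply]
  field_simp

/-- **EVERY `K`-INTERVAL LADDER'S MODEL ROUND TRIP IS AT LEAST THE UNIFORM LADDER'S** (same endpoints,
`Λ = g K − g 0`, `K ≥ 1`, `g` monotone): `2K(K+1)/gaussAcc(Λ/K) ≤ E_0(τ_K) + E_K(τ_0)`. [ours] -/
theorem model_round_trip_ge (hK : 0 < K) (hg : Monotone g)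
    (hh : IsHittingTimeSolution (profileWalk K (ladderProfile g)) h) :
    2 * ((K : ℝ) * (K + 1)) / gaussAcc ((g K - g 0) / K) ≤ h 0 (Fin.last K) + h (Fin.last K) 0 := by
  rw [model_round_trip hg hh]
  have hJ := mul_gaussInvAcc_div_le_sum hK g
  have hK1 : (0 : ℝ) ≤ 2 * ((K : ℝ) + 1) := by positivity
  calc 2 * ((K : ℝ) * (K + 1)) / gaussAcc ((g K - g 0) / K)
        = 2 * ((K : ℝ) + 1) * ((K : ℝ) * gaussInvAcc ((g K - g 0) / K)) := by
          rw [gaussInvAcc_apply]; field_simp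
    _ ≤ 2 * ((K : ℝ) + 1) * ∑ i ∈ range K, gaussInvAcc (ladderGap g i) := mul_le_mul_of_nonneg_left hJ hK1

/-- **UNIQUENESS: a ladder with some gap `≠ Λ/K` has a STRICTLY longer model round trip than the uniform
one.**  In the Gaussian swap model the equal-acceptance ladder (CARD-su3-ptbc §1.6) is the unique minimiser
of the round-trip time among the `K`-interval ladders with the same endpoints. [ours] -/
theorem model_round_trip_gt_of_ne_uniform (hK : 0 < K) (hg : Monotone g)
    (hne : ∃ i ∈ range K, ladderGap g i ≠ (g K - g 0) / K)
    (hh : IsHittingTimeSolution (profileWalk K (ladderProfile g)) h) :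
    2 * ((K : ℝ) * (K + 1)) / gaussAcc ((g K - g 0) / K) < h 0 (Fin.last K) + h (Fin.last K) 0 := by
  rw [model_round_trip hg hh]
  have hJ := mul_gaussInvAcc_div_lt_sum hK g hne
  have hK1 : (0 : ℝ) < 2 * ((K : ℝ) + 1) := by positivity
  calc 2 * ((K : ℝ) * (K + 1)) / gaussAcc ((g K - g 0) / K)
        = 2 * ((K : ℝ) + 1) * ((K : ℝ) * gaussInvAcc ((g K - g 0) / K)) := by
          rw [gaussInvAcc_apply]; field_simp
    _ < 2 * ((K : ℝ) + 1) * ∑ i ∈ range K, gaussInvAcc (ladderGap g i) := mul_lt_mul_of_pos_left hJ hK1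

/-- Conversely, if a monotone ladder's model round trip attains the uniform value, the ladder IS uniform
(every gap equals `Λ/K`). [ours] -/
theorem ladderGap_eq_div_of_model_round_trip_eq (hK : 0 < K) (hg : Monotone g)
    (hh : IsHittingTimeSolution (profileWalk K (ladderProfile g)) h)
    (heq : h 0 (Fin.last K) + h (Fin.last K) 0 = 2 * ((K : ℝ) * (K + 1)) / gaussAcc ((g K - g 0) / K)) :
    ∀ i ∈ range K, ladderGap g i = (g K - g 0) / K := by
  by_contra hcon
  push Not at hcon
  have hlt := model_round_trip_gt_of_ne_uniform hK hg hcon hh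
  rw [heq] at hlt
  exact lt_irrefl _ hlt

end Gauss

end Summit.Ventures.LatticeQCDFlow.Scaling

end
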